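import Literature.MathematicalPhysics.QuantumManyBody.LiebSimpleEquationProofs
import Literature.Analysis.FluidPDE.TaoAveragedRotationDisintegration
import Literature.Probability.Distributions.GaussianSphereMarginal
import HarnessLib

/-!
# Lieb's simple equation (Carlen–Jauslin–Lieb): the Yukawa resolvent identity

Topic: `Literature/MathematicalPhysics/QuantumManyBody`. First layer of the proof of CJL-I
Theorem 1 (`CarlenJauslinLieb2020_thm1`, existence and uniqueness for Lieb's simple equation,
Carlen–Jauslin–Lieb, Pure Appl. Anal. 2 (2020), arXiv:1912.04987, §2): the elementary theory of
the Yukawa potential `Y_c(x) = e^{-√c|x|}/(4π|x|)` on `ℝ³` (the kernel of `G = (−Δ + c)⁻¹`,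
CJL-I (1.8)–(1.9)) that CJL use tacitly through the resolvent `K_e = (−Δ + 4e + 𝒱)⁻¹` and the
resolvent identity (1.14) `K_e = G_e − G_e 𝒱 K_e`:

* one-dimensional exponential integrals (`integral_exp_neg_mul_Ioo`, …);
* **the resolvent identity for the kernels**, `Y_a ∗ Y_b = (Y_a − Y_b)/(b − a)` off the origin
  for `0 < a < b` (`lintegral_yukawa_mul_yukawa`), computed in bipolar coordinates (the tree's
  `Literature.Analysis.FluidPDE.Tao2016.lintegral_norm_norm_add`).

## References

* [CarlenJauslinLieb2020] E. A. Carlen, I. Jauslin, E. H. Lieb, *Analysis of a simple equation for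
  the ground state energy of the Bose gas*, Pure Appl. Anal. 2 (2020) 659–684, arXiv:1912.04987:
  (1.8)–(1.9), (1.13)–(1.15), §2.
* [LiebLoss2001] E. H. Lieb, M. Loss, *Analysis*, 2nd ed., AMS (2001), §6.23 (Yukawa potential).
-/

noncomputable section

open MeasureTheory Filter Set Real
open scoped ENNReal NNReal Topology

namespace Literature.MathematicalPhysics.QuantumManyBody

namespace LiebSimpleEquation

open BoseGas (Space)

/-! ## One-dimensional exponential integrals -/

/-- `∫_{(u,v)} e^{-ν r} dr = (e^{-ν u} − e^{-ν v})/ν` for `ν ≠ 0`, `u ≤ v`. [folklore] -/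
theorem integral_exp_neg_mul_Ioo {ν u v : ℝ} (hν : ν ≠ 0) (huv : u ≤ v) :
    ∫ r in Ioo u v, rexp (-(ν * r)) = (rexp (-(ν * u)) - rexp (-(ν * v))) / ν := by
  rw [← integral_Ioc_eq_integral_Ioo, ← intervalIntegral.integral_of_le huv]
  have hd : ∀ r ∈ uIcc u v, HasDerivAt (fun r => -rexp (-(ν * r)) / ν) (rexp (-(ν * r))) r := by
    intro r _
    refine ((((hasDerivAt_id' r).const_mul ν).neg.exp.neg).div_const ν).congr_deriv ?_
    simp only [Pi.neg_apply]
    field_simp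
  rw [intervalIntegral.integral_eq_sub_of_hasDerivAt hd
    ((by fun_prop : Continuous fun r => rexp (-(ν * r))).intervalIntegrable _ _)]
  field_simp
  ring

/-- `∫_{(u,v]} e^{κ r} dr = (e^{κ v} − e^{κ u})/κ` for `κ ≠ 0`, `u ≤ v`. [folklore] -/
theorem integral_exp_mul_Ioc {κ u v : ℝ} (hκ : κ ≠ 0) (huv : u ≤ v) :
    ∫ r in Ioc u v, rexp (κ * r) = (rexp (κ * v) - rexp (κ * u)) / κ := by
  rw [← intervalIntegral.integral_of_le huv]
  have hd : ∀ r ∈ uIcc u v, HasDerivAt (fun r => rexp (κ * r) / κ) (rexp (κ * r)) r := by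
    intro r _
    refine ((((hasDerivAt_id' r).const_mul κ).exp).div_const κ).congr_deriv ?_
    field_simp
  rw [intervalIntegral.integral_eq_sub_of_hasDerivAt hd
    ((by fun_prop : Continuous fun r => rexp (κ * r)).intervalIntegrable _ _)]
  field_simp

/-- `∫_{(R,∞)} e^{-κ r} dr = e^{-κ R}/κ` for `κ > 0`. [folklore] -/
theorem integral_exp_neg_mul_Ioi' {κ : ℝ} (hκ : 0 < κ) (R : ℝ) :
    ∫ r in Ioi R, rexp (-(κ * r)) = rexp (-(κ * R)) / κ := by
  have h := integral_exp_mul_Ioi (a := -κ) (by linarith) R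
  simp only [neg_mul] at h
  rw [h, neg_div_neg_eq]

/-- `r ↦ e^{-κ r}` is integrable on `(R, ∞)` for `κ > 0`. [folklore] -/
theorem integrableOn_exp_neg_mul_Ioi' {κ : ℝ} (hκ : 0 < κ) (R : ℝ) :
    IntegrableOn (fun r => rexp (-(κ * r))) (Ioi R) := by
  have h := integrableOn_exp_mul_Ioi (a := -κ) (by linarith) R
  simpa only [neg_mul] using h

/-- The radial integrand of the bipolar computation of `Y_a ∗ Y_b` is integrable on `(0, ∞)`
(it is bounded by `2e^{-α r}`). [folklore] -/
theorem integrableOn_exp_mul_exp_abs_sub {α : ℝ} (hα : 0 < α) (β R : ℝ) (hβ : 0 ≤ β) (hR : 0 ≤ R) :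
    IntegrableOn (fun r => rexp (-(α * r)) * (rexp (-(β * |R - r|)) - rexp (-(β * (R + r)))))
      (Ioi 0) := by
  refine Integrable.mono' ((integrableOn_exp_neg_mul_Ioi' hα 0).const_mul 2) ?_ ?_
  · exact (by fun_prop : Continuous fun r : ℝ =>
      rexp (-(α * r)) * (rexp (-(β * |R - r|)) - rexp (-(β * (R + r))))).aestronglyMeasurable
  · filter_upwards [ae_restrict_mem measurableSet_Ioi] with r hr
    have hr : 0 < r := hr
    rw [norm_mul, Real.norm_of_nonneg (exp_pos _).le, mul_comm]
    refine mul_le_mul_of_nonneg_right ?_ (exp_pos _).le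
    have h1 : rexp (-(β * |R - r|)) ≤ 1 := by
      rw [Real.exp_le_one_iff]; nlinarith [abs_nonneg (R - r)]
    have h2 : rexp (-(β * (R + r))) ≤ 1 := by
      rw [Real.exp_le_one_iff]; nlinarith
    have h3 := exp_pos (-(β * |R - r|))
    have h4 := exp_pos (-(β * (R + r)))
    rw [Real.norm_eq_abs, abs_le]
    constructor <;> linarith

/-- The radial integral of the bipolar computation of `Y_a ∗ Y_b`: for `α, β > 0`, `α ≠ β`,
`R ≥ 0`, `∫₀^∞ e^{-α r}(e^{-β|R - r|} − e^{-β(R + r)}) dr = (e^{-αR} − e^{-βR})(1/(β−α) + 1/(α+β))`.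
[folklore] -/
theorem integral_Ioi_exp_mul_exp_abs_sub {α β R : ℝ} (hα : 0 < α) (hβ : 0 < β) (hαβ : α ≠ β)
    (hR : 0 ≤ R) :
    ∫ r in Ioi 0, rexp (-(α * r)) * (rexp (-(β * |R - r|)) - rexp (-(β * (R + r)))) =
      (rexp (-(α * R)) - rexp (-(β * R))) * (1 / (β - α) + 1 / (α + β)) := by
  set F : ℝ → ℝ := fun r => rexp (-(α * r)) * (rexp (-(β * |R - r|)) - rexp (-(β * (R + r))))
    with hF
  have hFint : IntegrableOn F (Ioi 0) := integrableOn_exp_mul_exp_abs_sub hα β R hβ.le hR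
  -- split `(0, ∞) = (0, R] ∪ (R, ∞)`
  rw [show Ioi (0 : ℝ) = Ioc 0 R ∪ Ioi R from (Ioc_union_Ioi_eq_Ioi hR).symm,
    setIntegral_union Ioc_disjoint_Ioi_same measurableSet_Ioi
      (hFint.mono_set Ioc_subset_Ioi_self) (hFint.mono_set (Ioi_subset_Ioi hR))]
  -- the piece `(0, R]`
  have hIoc : ∫ r in Ioc 0 R, F r =
      rexp (-(β * R)) * ((rexp ((β - α) * R) - rexp ((β - α) * 0)) / (β - α) -
        (rexp (-(α + β) * R) - rexp (-(α + β) * 0)) / (-(α + β))) := by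
    have heq : EqOn F (fun r => rexp (-(β * R)) * (rexp ((β - α) * r) - rexp (-(α + β) * r)))
        (Ioc 0 R) := by
      intro r hr
      simp only [hF, abs_of_nonneg (sub_nonneg.2 hr.2), mul_sub, ← Real.exp_add]
      congr 1 <;> congr 1 <;> ring
    rw [setIntegral_congr_fun measurableSet_Ioc heq, integral_const_mul,
      integral_sub ((by fun_prop : Continuous fun r => rexp ((β - α) * r)).integrableOn_Icc.mono_set
        Ioc_subset_Icc_self)
        ((by fun_prop : Continuous fun r => rexp (-(α + β) * r)).integrableOn_Icc.mono_set
        Ioc_subset_Icc_self),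
      integral_exp_mul_Ioc (sub_ne_zero.2 hαβ.symm) hR,
      integral_exp_mul_Ioc (by linarith : -(α + β) ≠ 0) hR]
  -- the piece `(R, ∞)`
  have hIoi : ∫ r in Ioi R, F r =
      (rexp (β * R) - rexp (-(β * R))) * (rexp (-((α + β) * R)) / (α + β)) := by
    have heq : EqOn F (fun r => (rexp (β * R) - rexp (-(β * R))) * rexp (-((α + β) * r)))
        (Ioi R) := by
      intro r hr
      have hr' : R - r ≤ 0 := by linarith [mem_Ioi.1 hr]
      simp only [hF, abs_of_nonpos hr', mul_sub, sub_mul, ← Real.exp_add]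
      congr 1 <;> congr 1 <;> ring
    rw [setIntegral_congr_fun measurableSet_Ioi heq, integral_const_mul,
      integral_exp_neg_mul_Ioi' (by linarith) R]
  rw [hIoc, hIoi]
  -- algebra in the atoms `P = e^{αR}`, `Q = e^{βR}`
  have hP : 0 < rexp (α * R) := exp_pos _
  have hQ : 0 < rexp (β * R) := exp_pos _
  have e1 : rexp (-(α * R)) = (rexp (α * R))⁻¹ := Real.exp_neg _
  have e2 : rexp (-(β * R)) = (rexp (β * R))⁻¹ := Real.exp_neg _
  have e3 : rexp ((β - α) * R) = rexp (β * R) / rexp (α * R) := by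
    rw [sub_mul, Real.exp_sub]
  have e4 : rexp (-(α + β) * R) = (rexp (α * R))⁻¹ * (rexp (β * R))⁻¹ := by
    rw [neg_mul, Real.exp_neg, add_mul, Real.exp_add, mul_inv]
  have e5 : rexp (-((α + β) * R)) = (rexp (α * R))⁻¹ * (rexp (β * R))⁻¹ := by
    rw [Real.exp_neg, add_mul, Real.exp_add, mul_inv]
  have hβα : β - α ≠ 0 := sub_ne_zero.2 hαβ.symm
  have hαβ' : α + β ≠ 0 := by linarith
  simp only [mul_zero, Real.exp_zero]
  rw [e1, e2, e3, e4, e5]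
  field_simp
  ring

/-! ## The resolvent identity for the Yukawa kernels -/

/-- `Y_c(x) = e^{-√c|x|}/(4π|x|)` (definitional unfolding). [cite: CarlenJauslinLieb2020, (1.9)] -/
theorem yukawa_eq (c : ℝ) (x : Space) :
    yukawa c x = rexp (-(Real.sqrt c * ‖x‖)) / (4 * π * ‖x‖) := rfl

/-- **The resolvent identity for the Yukawa kernels** (`G_a − G_b = (b − a) G_a G_b` for
`G_c = (−Δ + c)⁻¹ = Y_c ∗`, CJL-I (1.13)–(1.15), at the level of kernels): for `0 < a < b` and
`x ≠ 0`, `∫ Y_a(y) Y_b(x − y) dy = (Y_a(x) − Y_b(x))/(b − a)`, in `ℝ≥0∞` form. Computed in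
bipolar coordinates (`Tao2016.lintegral_norm_norm_add`): the pair `(|y|, |y − x|)` has density
`2π r₁ r₂/|x|` on the triangle region. [cite: CarlenJauslinLieb2020, (1.13)–(1.15)] -/
theorem lintegral_yukawa_mul_yukawa {a b : ℝ} (ha : 0 < a) (hab : a < b) {x : Space}
    (hx : x ≠ 0) :
    ∫⁻ y, ENNReal.ofReal (yukawa a y) * ENNReal.ofReal (yukawa b (x - y)) =
      ENNReal.ofReal ((yukawa a x - yukawa b x) / (b - a)) := by
  set α := Real.sqrt a with hαdef
  set β := Real.sqrt b with hβdef
  have hb : 0 < b := ha.trans hab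
  have hα : 0 < α := Real.sqrt_pos.2 ha
  have hβ : 0 < β := Real.sqrt_pos.2 hb
  have hαβ : α < β := Real.sqrt_lt_sqrt ha.le hab
  have hR : 0 < ‖x‖ := norm_pos_iff.2 hx
  -- Step 1: bipolar coordinates
  set Φ : ℝ → ℝ → ℝ≥0∞ := fun r₁ r₂ =>
    ENNReal.ofReal (rexp (-(α * r₁)) / (4 * π * r₁)) *
      ENNReal.ofReal (rexp (-(β * r₂)) / (4 * π * r₂)) with hΦdef
  have hΦ : Measurable (Function.uncurry Φ) := by
    show Measurable fun p : ℝ × ℝ => ENNReal.ofReal (rexp (-(α * p.1)) / (4 * π * p.1)) *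
      ENNReal.ofReal (rexp (-(β * p.2)) / (4 * π * p.2))
    fun_prop
  have hLHS : (∫⁻ y, ENNReal.ofReal (yukawa a y) * ENNReal.ofReal (yukawa b (x - y))) =
      ∫⁻ y : Space, Φ ‖y‖ ‖y + -x‖ := by
    refine lintegral_congr fun y => ?_
    simp only [hΦdef, yukawa, ← sub_eq_add_neg, norm_sub_rev y x]
    rfl
  rw [hLHS, Literature.Analysis.FluidPDE.Tao2016.lintegral_norm_norm_add (neg_ne_zero.2 hx) Φ hΦ,
    norm_neg]
  set R := ‖x‖ with hRdef
  -- Step 2: the inner integral over `r₂`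
  have hinner : EqOn (fun r₁ => ∫⁻ r₂ in Ioo |R - r₁| (R + r₁), ENNReal.ofReal (r₁ * r₂) * Φ r₁ r₂)
      (fun r₁ => ENNReal.ofReal ((16 * π ^ 2 * β)⁻¹ *
        (rexp (-(α * r₁)) * (rexp (-(β * |R - r₁|)) - rexp (-(β * (R + r₁))))))) (Ioi 0) := by
    intro r₁ hr₁
    have hr₁ : 0 < r₁ := hr₁
    have hlo : 0 ≤ |R - r₁| := abs_nonneg _
    have hle : |R - r₁| ≤ R + r₁ := by
      rw [abs_le]; constructor <;> linarith
    have heq : EqOn (fun r₂ => ENNReal.ofReal (r₁ * r₂) * Φ r₁ r₂)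
        (fun r₂ => ENNReal.ofReal (rexp (-(α * r₁)) / (16 * π ^ 2)) * ENNReal.ofReal (rexp (-(β * r₂))))
        (Ioo |R - r₁| (R + r₁)) := by
      intro r₂ hr₂
      have hr₂ : 0 < r₂ := hlo.trans_lt hr₂.1
      simp only [hΦdef]
      rw [← ENNReal.ofReal_mul (by positivity), ← ENNReal.ofReal_mul (by positivity),
        ← ENNReal.ofReal_mul (by positivity)]
      congr 1
      field_simp
      ring
    simp only []
    rw [setLIntegral_congr_fun measurableSet_Ioo heq,
      lintegral_const_mul' _ _ ENNReal.ofReal_ne_top,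
      ← ofReal_integral_eq_lintegral_ofReal
        (((by fun_prop : Continuous fun r₂ => rexp (-(β * r₂))).integrableOn_Icc).mono_set
          Ioo_subset_Icc_self) (ae_of_all _ fun _ => (exp_pos _).le),
      integral_exp_neg_mul_Ioo hβ.ne' hle, ← ENNReal.ofReal_mul (by positivity)]
    congr 1
    field_simp
  rw [setLIntegral_congr_fun measurableSet_Ioi hinner]
  -- Step 3: the outer integral over `r₁`
  have hint := (integrableOn_exp_mul_exp_abs_sub hα β R hβ.le hR.le).const_mul (16 * π ^ 2 * β)⁻¹
  have hnn : 0 ≤ᵐ[volume.restrict (Ioi (0 : ℝ))] fun r₁ => (16 * π ^ 2 * β)⁻¹ *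
      (rexp (-(α * r₁)) * (rexp (-(β * |R - r₁|)) - rexp (-(β * (R + r₁))))) := by
    filter_upwards [ae_restrict_mem measurableSet_Ioi] with r₁ hr₁
    have hr₁ : 0 < r₁ := hr₁
    have hle : |R - r₁| ≤ R + r₁ := by
      rw [abs_le]; constructor <;> linarith
    have hexp : rexp (-(β * (R + r₁))) ≤ rexp (-(β * |R - r₁|)) :=
      Real.exp_le_exp.2 (by nlinarith)
    have : 0 ≤ rexp (-(α * r₁)) * (rexp (-(β * |R - r₁|)) - rexp (-(β * (R + r₁)))) :=
      mul_nonneg (exp_pos _).le (sub_nonneg.2 hexp)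
    positivity
  rw [← ofReal_integral_eq_lintegral_ofReal hint hnn, integral_const_mul,
    integral_Ioi_exp_mul_exp_abs_sub hα hβ hαβ.ne hR.le, ← ENNReal.ofReal_mul (by positivity)]
  -- Step 4: algebra
  congr 1
  have hba : b - a = (β - α) * (β + α) := by
    have h1 : β ^ 2 = b := Real.sq_sqrt hb.le
    have h2 : α ^ 2 = a := Real.sq_sqrt ha.le
    nlinarith
  have hβα : β - α ≠ 0 := sub_ne_zero.2 hαβ.ne'
  have hαβ' : α + β ≠ 0 := by linarith
  have hβα' : β + α ≠ 0 := by linarith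
  rw [yukawa_eq, yukawa_eq, ← hαdef, ← hβdef, ← hRdef, hba]
  field_simp
  ring

/-! ## Measurability, monotonicity in the mass, and `Lᵠ` membership of `Y_c` -/

/-- `Y_c ≤ Y_0 = 1/(4π|x|)` pointwise, and more generally `Y_{c'} ≤ Y_c` for `c ≤ c'`
(the kernels decrease with the mass). [folklore] -/
theorem yukawa_antitone {c c' : ℝ} (hcc' : c ≤ c') (x : Space) : yukawa c' x ≤ yukawa c x := by
  unfold yukawa
  refine div_le_div_of_nonneg_right (Real.exp_le_exp.2 ?_) (by positivity)
  have := Real.sqrt_le_sqrt hcc'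
  nlinarith [norm_nonneg x]

/-- `Y_c(x) ≤ 1/(4π|x|)`. [folklore] -/
theorem yukawa_le_inv_norm (c : ℝ) (x : Space) : yukawa c x ≤ (4 * π * ‖x‖)⁻¹ := by
  unfold yukawa
  rw [← one_div]
  refine div_le_div_of_nonneg_right (Real.exp_le_one_iff.2 ?_) (by positivity)
  have := Real.sqrt_nonneg c
  nlinarith [norm_nonneg x]

/-- The radial profile identity behind `Y_c ∈ Lᵠ`: for `r > 0`,
`r² (e^{-√c r}/(4πr))^q = (4π)^{-q} · r^{2-q} e^{-(q√c) r}`. [folklore] -/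
theorem sq_mul_yukawaProfile_rpow {c : ℝ} (q : ℝ) {r : ℝ} (hr : 0 < r) :
    r ^ 2 * (rexp (-(Real.sqrt c * r)) / (4 * π * r)) ^ q =
      (4 * π) ^ (-q) * (r ^ (2 - q) * rexp (-(q * Real.sqrt c) * r ^ (1 : ℝ))) := by
  have h4 : (0 : ℝ) < 4 * π := by positivity
  rw [Real.div_rpow (exp_pos _).le (by positivity), Real.mul_rpow h4.le hr.le, ← Real.exp_mul,
    Real.rpow_one, Real.rpow_sub hr, Real.rpow_two, Real.rpow_neg h4.le]
  have h1 : (4 * π) ^ q ≠ 0 := (Real.rpow_pos_of_pos h4 q).ne'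
  have h2 : r ^ q ≠ 0 := (Real.rpow_pos_of_pos hr q).ne'
  field_simp

/-- **`Y_c ∈ Lᵠ(ℝ³)` for `c > 0` and `1 ≤ q < 3`** (in particular `Y_c ∈ L^{p'}` for the
conjugate exponent of any `p > 3/2`, which is how the hypothesis `p > d/2` of CJL-I Theorem 1
enters: `G_e f = Y_{4e} ∗ f` is bounded for `f ∈ Lᵖ`). Polar coordinates:
`∫ Y_c^q = 4π ∫₀^∞ r² (e^{-√c r}/(4πr))^q dr = (4π)^{1-q} Γ(3 − q)/(q√c)^{3-q} < ∞`. [folklore] -/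
theorem memLp_yukawa {c : ℝ} (hc : 0 < c) {q : ℝ≥0∞} (hq1 : 1 ≤ q) (hq3 : q < 3) :
    MemLp (yukawa c) q := by
  have hqtop : q ≠ ∞ := ne_top_of_lt hq3
  have hq0 : q ≠ 0 := (zero_lt_one.trans_le hq1).ne'
  set q' := q.toReal with hq'
  have hq'1 : 1 ≤ q' := by
    rw [hq', ← ENNReal.toReal_one]; exact ENNReal.toReal_mono hqtop hq1
  have hq'3 : q' < 3 := by
    rw [hq', show (3 : ℝ) = (3 : ℝ≥0∞).toReal by norm_num]
    exact ENNReal.toReal_strict_mono (by norm_num) hq3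
  refine ⟨(show Measurable (yukawa c) by unfold yukawa; fun_prop).aestronglyMeasurable, ?_⟩
  rw [eLpNorm_lt_top_iff_lintegral_rpow_enorm_lt_top hq0 hqtop]
  -- polar coordinates
  have hrad := Literature.Probability.Distributions.lintegral_fun_norm_addHaar (volume : Measure Space)
    (fun r => ‖rexp (-(Real.sqrt c * r)) / (4 * π * r)‖ₑ ^ q') (by fun_prop)
  simp only [finrank_euclideanSpace_fin] at hrad
  change ∫⁻ x : Space, ‖rexp (-(Real.sqrt c * ‖x‖)) / (4 * π * ‖x‖)‖ₑ ^ q' < ∞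
  rw [hrad]
  refine ENNReal.mul_lt_top (ENNReal.mul_lt_top (by simp) ?_) ?_
  · exact measure_ball_lt_top
  -- the radial integral is the (finite) Bochner integral of an integrable function
  have hint : IntegrableOn (fun r : ℝ => (4 * π) ^ (-q') *
      (r ^ (2 - q') * rexp (-(q' * Real.sqrt c) * r ^ (1 : ℝ)))) (Ioi 0) :=
    (integrableOn_rpow_mul_exp_neg_mul_rpow (by linarith) le_rfl
      (mul_pos (by linarith) (Real.sqrt_pos.2 hc))).const_mul _
  have heq : EqOn (fun r : ℝ => ENNReal.ofReal (r ^ (3 - 1)) *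
      ‖rexp (-(Real.sqrt c * r)) / (4 * π * r)‖ₑ ^ q')
      (fun r => ‖(4 * π) ^ (-q') * (r ^ (2 - q') * rexp (-(q' * Real.sqrt c) * r ^ (1 : ℝ)))‖ₑ)
      (Ioi 0) := by
    intro r hr
    have hr : 0 < r := hr
    have hY : 0 ≤ rexp (-(Real.sqrt c * r)) / (4 * π * r) := by positivity
    simp only []
    rw [Real.enorm_eq_ofReal hY, ENNReal.ofReal_rpow_of_nonneg hY (by linarith),
      ← ENNReal.ofReal_mul (by positivity), show (3 - 1 : ℕ) = 2 from rfl,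
      sq_mul_yukawaProfile_rpow q' hr, Real.enorm_eq_ofReal (by positivity)]
  rw [setLIntegral_congr_fun measurableSet_Ioi heq]
  exact hint.2

end LiebSimpleEquation

end Literature.MathematicalPhysics.QuantumManyBody
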